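import Mathlib
import Summits.ValiantsHypothesis.ValiantsHypothesis.Theorems.DivisionGapPerMultiplesHardDensePerHardReg
import Summits.ValiantsHypothesis.ValiantsHypothesis.Theorems.DivisionGapPerMultiplesHardRelDenseHost
import Summits.ValiantsHypothesis.ValiantsHypothesis.Theorems.DivisionGapPerMultiplesHardRelDenseCompleteClass
import Literature.Combinatorics.Enumerative.VanDerWaerdenPermanent
import Literature.Combinatorics.Enumerative.VanDerWaerdenPermanentProofs
import Literature.Computability.AlgebraicComplexity.ArithCircuitProofs
import Literature.Computability.AlgebraicComplexity.PermanentIrreducible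

/-!
# The dense-host rungs of crux `PerMultiplesHard`, UNCONDITIONAL

Item `stmt-ValiantsHypothesis-5068` (route `DivisionGap`, line `uncharged-face-walk`, lead c6).  Three landed
theorems of this line take the van der Waerden permanent bound (Egorychev–Falikman) as an explicit hypothesis:
`DensePerHardReg.densePerHardReg` (p112827: for `k`-regular hosts `G`, `k^n · 3^n · 3^{⌊n/3⌋+1} ≤
L(per_G)² · n^n · poly · 2^{…}`, i.e. `L(per_G) ≥ 2^{Ω(n)}` for density `k/n ≥ 0.43`), `RelDenseHost.stub_relDenseHost`
(p127004: the relative spread jaw on a quasi-random host) and `RelDenseCompleteClass.relDenseCompleteClassHard`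
(p127756: complete-class multiples of `per_G` on a quasi-random host cost `(5/4)^{n/10} e^{-o(n)}`).  The named fact is now
DISCHARGED in the tree (`Literature.Combinatorics.Enumerative.VanDerWaerdenPermanent_holds`, p128756, Gurvits' capacity
proof assembled from this line's wave-1 Literature files p128059, p127994, p128003, p127956), so the three rungs hold
outright; this file records the unconditional forms (`…_unconditional`), which are the ones the crux notes cite.
-/

noncomputable section

-- `Summit.ValiantsHypothesis.ValiantsHypothesis.…` is the tree's mandated layout (Sub = Summit).
set_option linter.dupNamespace false

namespace Summit.ValiantsHypothesis.ValiantsHypothesis.Theorems.DivisionGap.PerMultiplesHard.DenseHostUnconditional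

open MvPolynomial Literature.Computability.AlgebraicComplexity
open scoped NNReal BigOperators

/-- **`DensePerHard` for regular hosts, unconditional**: for `n ≥ 9` and a `k`-regular host `G ⊆ [n]²` (`k ≥ 1`),
`k^n · 3^n · 3^{⌊n/3⌋+1} ≤ L(per_G)² · n^n · (n+1)(⌊n/3⌋+2) · 2^{n−⌊n/3⌋} · 2^{(⌊n/3⌋+1) − (⌊n/3⌋+1)/3}` — the landed
`densePerHardReg` with its van der Waerden hypothesis discharged by `VanDerWaerdenPermanent_holds`.
[cite: JerrumSnir1982, §3–4] -/
theorem densePerHardReg_unconditional :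
    ∀ n ≥ 9, ∀ (k : ℕ) (G : Finset (Fin n × Fin n)), 1 ≤ k →
      (∀ i : Fin n, (Finset.univ.filter fun j : Fin n => (i, j) ∈ G).card = k) →
      (∀ j : Fin n, (Finset.univ.filter fun i : Fin n => (i, j) ∈ G).card = k) →
      k ^ n * (3 ^ n * 3 ^ (n / 3 + 1)) ≤
        complexity (∑ σ ∈ (Finset.univ : Finset (Equiv.Perm (Fin n))).filter
            (fun σ => ∀ i, (σ i, i) ∈ G), monomial (permMonomial σ) (1 : ℝ≥0)) ^ 2 *
          (n ^ n * ((n + 1) * (n / 3 + 2) *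
            (2 ^ (n - n / 3) * 2 ^ ((n / 3 + 1) - (n / 3 + 1) / 3)))) :=
  DensePerHardReg.densePerHardReg Literature.Combinatorics.Enumerative.VanDerWaerdenPermanent_holds

/-- **The relative spread jaw on a dense host, unconditional**: the landed `RelDenseHost.stub_relDenseHost` with its
van der Waerden hypothesis discharged.  For `n ≥ 5`, a host `Y` containing an `f`-regular spanning subgraph `Y'` (`f ≥ 1`)
and obeying the upper mixing bound `e_Y(A,B) ≤ β·#A·#B + εn²`, and a torus-homogeneous `g` with all rows hit such that every
permutation inside `Y` carries a `ζ`-spread probe in `supp g`: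
`f^n · 5^{⌊n/10⌋} ≤ L(g) · (βn)^n · 4^{⌊n/10⌋} · exp(15εn/β + (log n + 12)/β)`. [folklore] -/
theorem relDenseHost_unconditional :
    ∀ n ≥ 5, ∀ (Y Y' : Finset (Fin n × Fin n)) (f : ℕ), Y' ⊆ Y → 1 ≤ f →
      (∀ i : Fin n, (Finset.univ.filter fun j : Fin n => (i, j) ∈ Y').card = f) →
      (∀ j : Fin n, (Finset.univ.filter fun i : Fin n => (i, j) ∈ Y').card = f) →
      ∀ (β ε : ℝ), 0 < β → β ≤ 1 → 0 ≤ ε → ε ≤ 1 →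
      (∀ A B : Finset (Fin n),
        ((Y.filter fun e => e.1 ∈ A ∧ e.2 ∈ B).card : ℝ) ≤ β * A.card * B.card + ε * (n : ℝ) ^ 2) →
      ∀ (ζ : Equiv.Perm (Fin n)) (g : MvPolynomial (Fin n × Fin n) ℝ≥0) (R C : Fin n → ℕ),
        (∀ m ∈ g.support, (∀ i, ∑ j, m (i, j) = R i) ∧ (∀ j, ∑ i, m (i, j) = C j)) →
        (∀ i, R i ≠ 0) →
        (∀ π : Equiv.Perm (Fin n), (∀ j, (π j, j) ∈ Y) →
          ∃ M ∈ g.support, ∀ e ∈ M.support, π e.2 = e.1 ∨ π e.2 = ζ e.1) →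
        (f : ℝ) ^ n * (5 : ℝ) ^ (n / 10) ≤
          (complexity g : ℝ) * (β * n) ^ n * (4 : ℝ) ^ (n / 10) *
            Real.exp (15 * ε * n / β + (Real.log n + 12) / β) :=
  RelDenseHost.stub_relDenseHost Literature.Combinatorics.Enumerative.VanDerWaerdenPermanent_holds

/-- **The dense-host complete-class rung, unconditional** (the formal kill of the candidate `h_prand` of the crux notes §F1
for explicitly quasi-random hosts): the landed `RelDenseCompleteClass.relDenseCompleteClassHard` with its van der Waerden
hypothesis discharged.  For `n ≥ 5`, a host `G`, `Y := G ∩ ζG` (`ζ = finRotate n`) containing an `f`-regular spanning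
subgraph and obeying the upper mixing bound, and a torus-homogeneous `t` COMPLETE on `G` with balanced close margins of offset
`> n²`: `f^n · 5^{⌊n/10⌋} ≤ L(per_G · t) · (βn)^n · 4^{⌊n/10⌋} · exp(15εn/β + (log n + 12)/β)`. [folklore] -/
theorem relDenseCompleteClassHard_unconditional :
    ∀ n ≥ 5, ∀ (G Y' : Finset (Fin n × Fin n)) (f : ℕ),
      Y' ⊆ G.filter (fun e => ((finRotate n).symm e.1, e.2) ∈ G) → 1 ≤ f →
      (∀ i : Fin n, (Finset.univ.filter fun j : Fin n => (i, j) ∈ Y').card = f) →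
      (∀ j : Fin n, (Finset.univ.filter fun i : Fin n => (i, j) ∈ Y').card = f) →
      ∀ (β ε : ℝ), 0 < β → β ≤ 1 → 0 ≤ ε → ε ≤ 1 →
      (∀ A B : Finset (Fin n),
        (((G.filter (fun e => ((finRotate n).symm e.1, e.2) ∈ G)).filter fun e => e.1 ∈ A ∧ e.2 ∈ B).card : ℝ) ≤
          β * A.card * B.card + ε * (n : ℝ) ^ 2) →
      ∀ (t : MvPolynomial (Fin n × Fin n) ℝ≥0) (R C : Fin n → ℕ),
        (∀ m ∈ t.support, (∀ i, ∑ j, m (i, j) = R i) ∧ (∀ j, ∑ i, m (i, j) = C j)) →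
        (∀ M : (Fin n × Fin n) →₀ ℕ, M.support ⊆ G →
          (∀ i, ∑ j, M (i, j) = R i) → (∀ j, ∑ i, M (i, j) = C j) → M ∈ t.support) →
        ∑ i, R i = ∑ j, C j → (∀ i j, R i ≤ C j + n ∧ C j ≤ R i + n) → (∀ i, n ^ 2 + 1 ≤ R i) →
        (f : ℝ) ^ n * (5 : ℝ) ^ (n / 10) ≤
          (complexity ((∑ σ ∈ (Finset.univ : Finset (Equiv.Perm (Fin n))).filter (fun σ => ∀ i, (σ i, i) ∈ G),
              monomial (permMonomial σ) (1 : ℝ≥0)) * t) : ℝ) * (β * n) ^ n * (4 : ℝ) ^ (n / 10) *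
            Real.exp (15 * ε * n / β + (Real.log n + 12) / β) :=
  RelDenseCompleteClass.relDenseCompleteClassHard Literature.Combinatorics.Enumerative.VanDerWaerdenPermanent_holds

end Summit.ValiantsHypothesis.ValiantsHypothesis.Theorems.DivisionGap.PerMultiplesHard.DenseHostUnconditional

end
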